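import Summits.Ventures.CertifiedArithmetic.LowPrec.GemmThetaE5M2Defs

/-!
# θ-certificate of E5M2²→bfloat16: the global tables, kernel-checked

HONEST FRAMING (venture CertifiedArithmetic / cell `pub-lowprec`, seat gemm, gen 9): certified error
envelopes and provably optimal rounding/accumulation schemes for low-precision formats under stated
cost models; every table by two implementations; no hardware or vendor claims.

Paper `gemm.tex` §Regimes Prop. Θ(i), instance E5M2·E5M2→`bfloat16`: the letter-independent part of the
compressed certificate of `GemmThetaE5M2Defs.lean`, by `decide +kernel` — the absorption windows of all
`2 · 8449` signed states (`statesOK`: two roundings each), the window chains (`winChainOK 1`, `2`), the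
value/potential chain (`monoChainOK`), the start checks of the 1211 letters with the letter count, and
the two saturation witnesses at `±2^72`.  Used by `GemmThetaE5M2Sound.lean`.
-/

namespace Literature.ComputerArithmetic.FloatingPoint

namespace MiniFloat

namespace ThetaE5M2

/-- Windows of the states `0..1299`. [cell certificate, kernel-checked] -/
theorem states_ok_0 : statesOK 0 1300 = true := by
  decide +kernel

/-- Windows of the states `1300..2599`. [cell certificate, kernel-checked] -/
theorem states_ok_1 : statesOK 1300 1300 = true := by
  decide +kernel

/-- Windows of the states `2600..3899`. [cell certificate, kernel-checked] -/
theorem states_ok_2 : statesOK 2600 1300 = true := by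
  decide +kernel

/-- Windows of the states `3900..5199`. [cell certificate, kernel-checked] -/
theorem states_ok_3 : statesOK 3900 1300 = true := by
  decide +kernel

/-- Windows of the states `5200..6499`. [cell certificate, kernel-checked] -/
theorem states_ok_4 : statesOK 5200 1300 = true := by
  decide +kernel

/-- Windows of the states `6500..7799`. [cell certificate, kernel-checked] -/
theorem states_ok_5 : statesOK 6500 1300 = true := by
  decide +kernel

/-- Windows of the states `7800..8448`. [cell certificate, kernel-checked] -/
theorem states_ok_6 : statesOK 7800 649 = true := by
  decide +kernel

/-- The window chains with step `1` (absorbed runs), lower half. [cell certificate, kernel-checked] -/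
theorem winChain_one_lo : winChainOK 1 0 4225 = true := by
  decide +kernel

/-- The window chains with step `1`, upper half. [cell certificate, kernel-checked] -/
theorem winChain_one_hi : winChainOK 1 4225 4224 = true := by
  decide +kernel

/-- The window chains with step `2` (parity classes), lower half. [cell certificate, kernel-checked] -/
theorem winChain_two_lo : winChainOK 2 0 4225 = true := by
  decide +kernel

/-- The window chains with step `2`, upper half. [cell certificate, kernel-checked] -/
theorem winChain_two_hi : winChainOK 2 4225 4224 = true := by
  decide +kernel

/-- `valG` strictly increasing, `Φ` nondecreasing along the indices `0..8448`. [cell certificate,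
kernel-checked] -/
theorem monoChain_ok : monoChainOK 0 8448 = true := by
  decide +kernel

/-- Every letter passes `startOK`, and there are `1211` letters. [cell certificate, kernel-checked] -/
theorem starts_len_ok : (lamG.all startOK && lamG.length == 1211) = true := by
  decide +kernel

/-- Saturation witness: the top state absorbs the largest letter upward. [cell, kernel-checked] -/
theorem rne8_top_add : rne8 (4722366482869645213696 + 14123288431433875456) = 4722366482869645213696 := by
  decide +kernel

/-- Saturation witness, negative side. [cell, kernel-checked] -/
theorem rne8_bot_sub : rne8 (-4722366482869645213696 - 14123288431433875456) = -4722366482869645213696 := by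
  decide +kernel

end ThetaE5M2

end MiniFloat

end Literature.ComputerArithmetic.FloatingPoint
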